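import Literature.Probability.LatticeModels.CollarLegModel

/-!
# `CollarLegModel`: the height bound in `configs` is redundant

For the closed-collar `Δ = -1/2` height model `Literature.Probability.LatticeModels.CollarLegModel`
(file `CollarLegModel.lean`), height configurations were defined as the VALID assignments of
heights in `[-B, B]` to the free cells, `B = CollarLegModel.bound = sup |vertH| + sup |faceH| +
2|V| + 2`, so that finiteness is manifest. This file proves that the bound is no restriction:

* `mem_configs_of_isValid` / `mem_configs_iff_isValid` — **every valid assignment
  `h : freeCells → ℤ` is a configuration**, i.e. `configs` is exactly the set of height functions of
  the request (`|h x − h f| = 1` across every vertex/face corner pair with a free member) and `Z`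
  sums over all of them.

The proof is the north-east diagonal walk: a free vertex `v` looks at its north-east face `v`;
if that face is a collar face or a pocket (one unit from a ghost) the height of `v` is within `2`
of a prescribed height; otherwise the face is interior, `v + (1,1) ∈ V`, `|h v − h (v+(1,1))| ≤ 2`,
and one recurses — the number of diagonal successors of `v` in `V` drops (`abs_hv_le_of_card_le`,
induction on that number, at most `|V| − 1`). Faces are one unit from a corner vertex.
Auxiliary unfolding lemmas (`mem_freeCells_false/true`, `hv_of_mem`, …) are recorded on the way.

## References

* R. J. Baxter, S. B. Kelland, F. Y. Wu, J. Phys. A 9 (1976) 397–406. [BaxterKellandWu1976]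
* Ledger item `defn-CollarLegModel` (route CardyBoundaryCoulombGas): the requested surface
  "HeightConfig (Fintype)".
-/

namespace Literature.Probability.LatticeModels.CollarLegModel

section Configs

/-- Membership in `configs`: bounded values and validity. [folklore] -/
theorem mem_configs_iff (M : CollarLegModel) (h : ↥M.freeCells → ℤ) :
    h ∈ M.configs ↔
      (h ∈ Fintype.piFinset fun _ : ↥M.freeCells => Finset.Icc (-(M.bound : ℤ)) M.bound) ∧ M.IsValid h :=
  Finset.mem_filter

variable (M : CollarLegModel)

/-- Free cells tagged `false` are the free vertices. [folklore] -/
theorem mem_freeCells_false {x : ℤ × ℤ} : (x, false) ∈ M.freeCells ↔ x ∈ M.freeVerts := by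
  simp [freeCells]

/-- Free cells tagged `true` are the free faces. [folklore] -/
theorem mem_freeCells_true {f : ℤ × ℤ} : (f, true) ∈ M.freeCells ↔ f ∈ M.freeFaces := by
  simp [freeCells]

/-- The height of a free vertex is the configuration's value. [folklore] -/
theorem hv_of_mem (h : ↥M.freeCells → ℤ) {x : ℤ × ℤ} (hx : (x, false) ∈ M.freeCells) :
    M.hv h x = h ⟨(x, false), hx⟩ := by
  simp [hv, hx]

/-- The height of a non-free vertex-cell is the prescribed one. [folklore] -/
theorem hv_of_not_mem (h : ↥M.freeCells → ℤ) {x : ℤ × ℤ} (hx : (x, false) ∉ M.freeCells) :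
    M.hv h x = M.C.vertH x := by
  simp [hv, hx]

/-- The height of a free face is the configuration's value. [folklore] -/
theorem hf_of_mem (h : ↥M.freeCells → ℤ) {f : ℤ × ℤ} (hx : (f, true) ∈ M.freeCells) :
    M.hf h f = h ⟨(f, true), hx⟩ := by
  simp [hf, hx]

/-- The height of a non-free face-cell is the prescribed one. [folklore] -/
theorem hf_of_not_mem (h : ↥M.freeCells → ℤ) {f : ℤ × ℤ} (hx : (f, true) ∉ M.freeCells) :
    M.hf h f = M.C.faceH f := by
  simp [hf, hx]

/-- A vertex is a corner of its north-east face. [folklore] -/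
theorem self_mem_vertexFaces (v : ℤ × ℤ) : v ∈ SixVertex.vertexFaces v := by
  simp [SixVertex.vertexFaces]

/-- `v` is the south-west corner … : the face `v` has `v + (1,1)` as a corner. [folklore] -/
theorem mem_vertexFaces_diag (v : ℤ × ℤ) : v ∈ SixVertex.vertexFaces (v.1 + 1, v.2 + 1) := by
  simp [SixVertex.vertexFaces]

/-- Corner / face incidence read from either side. [folklore] -/
theorem mem_vertexFaces_of_mem_faceCorners {f g : ℤ × ℤ} (hg : g ∈ SixVertex.faceCorners f) :
    f ∈ SixVertex.vertexFaces g := by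
  obtain ⟨a, b⟩ := f
  simp only [SixVertex.faceCorners, Finset.mem_insert, Finset.mem_singleton] at hg
  rcases hg with rfl | rfl | rfl | rfl <;> simp [SixVertex.vertexFaces]

/-- The faces at a vertex of `V` are face-cells. [folklore] -/
theorem mem_faceCells_of_mem_vertexFaces {v f : ℤ × ℤ} (hv : v ∈ M.V)
    (hf : f ∈ SixVertex.vertexFaces v) : f ∈ M.faceCells :=
  Finset.mem_biUnion.mpr ⟨v, hv, hf⟩

/-- Prescribed vertex heights are bounded by the first `sup` in `bound`. [folklore] -/
theorem abs_vertH_le {x : ℤ × ℤ} (hx : x ∈ M.vertexCells) :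
    |M.C.vertH x| ≤ (M.vertexCells.sup fun x => (M.C.vertH x).natAbs : ℕ) := by
  rw [Int.abs_eq_natAbs]
  exact_mod_cast Finset.le_sup (f := fun x => (M.C.vertH x).natAbs) hx

/-- Prescribed face heights are bounded by the second `sup` in `bound`. [folklore] -/
theorem abs_faceH_le {f : ℤ × ℤ} (hf : f ∈ M.faceCells) :
    |M.C.faceH f| ≤ (M.faceCells.sup fun f => (M.C.faceH f).natAbs : ℕ) := by
  rw [Int.abs_eq_natAbs]
  exact_mod_cast Finset.le_sup (f := fun f => (M.C.faceH f).natAbs) hf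

/-- A pocket is one unit from a ghost: its height is within `sup |vertH| + 1`. [folklore] -/
theorem abs_hf_le_of_mem_pockets {h : ↥M.freeCells → ℤ} (hval : M.IsValid h) {f : ℤ × ℤ}
    (hf : f ∈ M.pockets) :
    |M.hf h f| ≤ (M.vertexCells.sup fun x => (M.C.vertH x).natAbs : ℕ) + 1 := by
  have hbd : f ∈ SixVertex.bdryFaces M.V := (Finset.mem_inter.mp hf).2
  have hfaces : f ∈ M.faceCells := (Finset.mem_filter.mp hbd).1
  obtain ⟨g, hg, hgV⟩ : ∃ g ∈ SixVertex.faceCorners f, g ∉ M.V :=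
    Finset.not_subset.mp (Finset.mem_filter.mp hbd).2
  have hghost : g ∈ M.ghosts := by
    refine Finset.mem_sdiff.mpr ⟨Finset.mem_union_right _ ?_, hgV⟩
    exact Finset.mem_biUnion.mpr ⟨f, hf, hg⟩
  have hgcell : g ∈ M.vertexCells := Finset.mem_union_right _ hghost
  have hgfree : (g, false) ∉ M.freeCells := by
    rw [mem_freeCells_false]
    exact fun h' => hgV (Finset.mem_sdiff.mp h').1
  have hffree : (f, true) ∈ M.freeCells := (mem_freeCells_true M).mpr (Finset.mem_union_right _ hf)
  have h1 := hval g hgcell f (mem_vertexFaces_of_mem_faceCorners hg) hfaces (Or.inr hffree)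
  rw [hv_of_not_mem M h hgfree] at h1
  have h2 := M.abs_vertH_le hgcell
  have h3 : |M.hf h f| ≤ |M.C.vertH g| + 1 := by
    have := abs_sub_abs_le_abs_sub (M.hf h f) (M.C.vertH g)
    rw [abs_sub_comm] at this
    linarith
  linarith

/-- The diagonal successors of `v` in `V`. [folklore] -/
theorem card_diag_lt {v : ℤ × ℤ} (hv : v ∈ M.V) :
    (M.V.filter fun w => w.1 - v.1 = w.2 - v.2 ∧ v.1 < w.1).card < M.V.card := by
  apply Finset.card_lt_card
  refine Finset.filter_ssubset.mpr ⟨v, hv, ?_⟩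
  simp

/-- **Main step**: a free vertex with at most `n` diagonal successors in `V` has height at most
`sup |vertH| + sup |faceH| + 2 + 2n`. [folklore] -/
theorem abs_hv_le_of_card_le {h : ↥M.freeCells → ℤ} (hval : M.IsValid h) :
    ∀ n : ℕ, ∀ v ∈ M.freeVerts,
      (M.V.filter fun w => w.1 - v.1 = w.2 - v.2 ∧ v.1 < w.1).card ≤ n →
      |M.hv h v| ≤ (M.vertexCells.sup fun x => (M.C.vertH x).natAbs : ℕ) +
        (M.faceCells.sup fun f => (M.C.faceH f).natAbs : ℕ) + 2 + 2 * n := by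
  set Mv : ℕ := M.vertexCells.sup fun x => (M.C.vertH x).natAbs with hMv
  set Mf : ℕ := M.faceCells.sup fun f => (M.C.faceH f).natAbs with hMf
  intro n
  induction n with
  | zero => ?_
  | succ n ih => ?_
  all_goals intro v hv hcard
  all_goals
    have hvV : v ∈ M.V := (Finset.mem_sdiff.mp hv).1
    have hvfree : (v, false) ∈ M.freeCells := (mem_freeCells_false M).mpr hv
    have hvcell : v ∈ M.vertexCells := Finset.mem_union_left _ hvV
    have hf₀ : v ∈ M.faceCells := M.mem_faceCells_of_mem_vertexFaces hvV (self_mem_vertexFaces v)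
    have h1 := hval v hvcell v (self_mem_vertexFaces v) hf₀ (Or.inl hvfree)
    have hMv0 : (0 : ℤ) ≤ Mv := by positivity
    have hMf0 : (0 : ℤ) ≤ Mf := by positivity
  · -- n = 0
    by_cases hff : (v, true) ∈ M.freeCells
    · have hff' := (mem_freeCells_true M).mp hff
      rcases Finset.mem_union.mp hff' with hint | hpk
      · -- interior: the diagonal successor exists, contradiction with card ≤ 0
        exfalso
        have hsub : SixVertex.faceCorners v ⊆ M.V := (Finset.mem_filter.mp hint).2
        have hv' : (v.1 + 1, v.2 + 1) ∈ M.V := hsub (by simp [SixVertex.faceCorners])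
        have : (v.1 + 1, v.2 + 1) ∈ (M.V.filter fun w => w.1 - v.1 = w.2 - v.2 ∧ v.1 < w.1) := by
          simp [hv']
        rw [Nat.le_zero, Finset.card_eq_zero] at hcard
        rw [hcard] at this
        simp at this
      · have h2 := M.abs_hf_le_of_mem_pockets hval hpk
        have h3 : |M.hv h v| ≤ |M.hf h v| + 1 := by
          have := abs_sub_abs_le_abs_sub (M.hv h v) (M.hf h v)
          linarith
        push_cast
        linarith
    · rw [hf_of_not_mem M h hff] at h1
      have h2 := M.abs_faceH_le hf₀
      have h3 : |M.hv h v| ≤ |M.C.faceH v| + 1 := by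
        have := abs_sub_abs_le_abs_sub (M.hv h v) (M.C.faceH v)
        linarith
      push_cast
      linarith
  · -- n + 1
    by_cases hff : (v, true) ∈ M.freeCells
    · have hff' := (mem_freeCells_true M).mp hff
      rcases Finset.mem_union.mp hff' with hint | hpk
      · have hsub : SixVertex.faceCorners v ⊆ M.V := (Finset.mem_filter.mp hint).2
        have hv'V : (v.1 + 1, v.2 + 1) ∈ M.V := hsub (by simp [SixVertex.faceCorners])
        have hv'cell : (v.1 + 1, v.2 + 1) ∈ M.vertexCells := Finset.mem_union_left _ hv'V
        have h2 := hval (v.1 + 1, v.2 + 1) hv'cell v (mem_vertexFaces_diag v) hf₀ (Or.inr hff)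
        -- |hv v - hv v'| ≤ 2
        have h12 : |M.hv h v - M.hv h (v.1 + 1, v.2 + 1)| ≤ 2 := by
          have := abs_sub_le (M.hv h v) (M.hf h v) (M.hv h (v.1 + 1, v.2 + 1))
          rw [abs_sub_comm (M.hf h v)] at this
          linarith
        by_cases hv'free : ((v.1 + 1, v.2 + 1), false) ∈ M.freeCells
        · -- recurse
          have hv'fv : (v.1 + 1, v.2 + 1) ∈ M.freeVerts := (mem_freeCells_false M).mp hv'free
          have hcard' : (M.V.filter fun w => w.1 - (v.1 + 1, v.2 + 1).1 = w.2 - (v.1 + 1, v.2 + 1).2 ∧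
              (v.1 + 1, v.2 + 1).1 < w.1).card ≤ n := by
            have hss : (M.V.filter fun w => w.1 - (v.1 + 1, v.2 + 1).1 = w.2 - (v.1 + 1, v.2 + 1).2 ∧
                (v.1 + 1, v.2 + 1).1 < w.1) ⊆
                (M.V.filter fun w => w.1 - v.1 = w.2 - v.2 ∧ v.1 < w.1).erase (v.1 + 1, v.2 + 1) := by
              intro w hw
              simp only [Finset.mem_filter] at hw
              simp only [Finset.mem_erase, Finset.mem_filter]
              refine ⟨?_, hw.1, ?_, ?_⟩
              · intro heq
                rw [heq] at hw
                simp at hw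
              · omega
              · omega
            have hmem : (v.1 + 1, v.2 + 1) ∈ (M.V.filter fun w => w.1 - v.1 = w.2 - v.2 ∧ v.1 < w.1) := by
              simp [hv'V]
            have := Finset.card_le_card hss
            rw [Finset.card_erase_of_mem hmem] at this
            omega
          have h3 := ih _ hv'fv hcard'
          have h4 : |M.hv h v| ≤ |M.hv h (v.1 + 1, v.2 + 1)| + 2 := by
            have := abs_sub_abs_le_abs_sub (M.hv h v) (M.hv h (v.1 + 1, v.2 + 1))
            linarith
          push_cast at h3 ⊢
          linarith
        · rw [hv_of_not_mem M h hv'free] at h12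
          have h3 := M.abs_vertH_le hv'cell
          have h4 : |M.hv h v| ≤ |M.C.vertH (v.1 + 1, v.2 + 1)| + 2 := by
            have := abs_sub_abs_le_abs_sub (M.hv h v) (M.C.vertH (v.1 + 1, v.2 + 1))
            linarith
          push_cast
          linarith
      · have h2 := M.abs_hf_le_of_mem_pockets hval hpk
        have h3 : |M.hv h v| ≤ |M.hf h v| + 1 := by
          have := abs_sub_abs_le_abs_sub (M.hv h v) (M.hf h v)
          linarith
        push_cast
        linarith
    · rw [hf_of_not_mem M h hff] at h1
      have h2 := M.abs_faceH_le hf₀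
      have h3 : |M.hv h v| ≤ |M.C.faceH v| + 1 := by
        have := abs_sub_abs_le_abs_sub (M.hv h v) (M.C.faceH v)
        linarith
      push_cast
      linarith

/-- Free vertices have height at most `bound − 2`. [folklore] -/
theorem abs_hv_le_of_isValid {h : ↥M.freeCells → ℤ} (hval : M.IsValid h) {v : ℤ × ℤ}
    (hv : v ∈ M.freeVerts) : |M.hv h v| + 2 ≤ M.bound := by
  have hvV : v ∈ M.V := (Finset.mem_sdiff.mp hv).1
  have hlt := M.card_diag_lt hvV
  have h1 := M.abs_hv_le_of_card_le hval (M.V.card - 1) v hv (by omega)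
  unfold bound
  push_cast at h1 ⊢
  have : (1 : ℕ) ≤ M.V.card := Finset.card_pos.mpr ⟨v, hvV⟩
  have hc : ((M.V.card - 1 : ℕ) : ℤ) = (M.V.card : ℤ) - 1 := by omega
  rw [hc] at h1
  linarith

/-- Free faces have height at most `bound`. [folklore] -/
theorem abs_hf_le_of_isValid {h : ↥M.freeCells → ℤ} (hval : M.IsValid h) {f : ℤ × ℤ}
    (hf : (f, true) ∈ M.freeCells) : |M.hf h f| ≤ M.bound := by
  rcases Finset.mem_union.mp ((mem_freeCells_true M).mp hf) with hint | hpk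
  · have hsub : SixVertex.faceCorners f ⊆ M.V := (Finset.mem_filter.mp hint).2
    have hfV : f ∈ M.V := hsub (by simp [SixVertex.faceCorners])
    have hfcell : f ∈ M.vertexCells := Finset.mem_union_left _ hfV
    have hfaces : f ∈ M.faceCells := (Finset.mem_filter.mp hint).1
    have h1 := hval f hfcell f (self_mem_vertexFaces f) hfaces (Or.inr hf)
    have h2 : |M.hf h f| ≤ |M.hv h f| + 1 := by
      have := abs_sub_abs_le_abs_sub (M.hf h f) (M.hv h f)
      rw [abs_sub_comm] at h1
      linarith
    by_cases hffree : (f, false) ∈ M.freeCells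
    · have h3 := M.abs_hv_le_of_isValid hval ((mem_freeCells_false M).mp hffree)
      linarith
    · rw [hv_of_not_mem M h hffree] at h2
      have h3 := M.abs_vertH_le hfcell
      unfold bound
      push_cast
      have : (0 : ℤ) ≤ (M.faceCells.sup fun f => (M.C.faceH f).natAbs : ℕ) := by positivity
      linarith
  · have h1 := M.abs_hf_le_of_mem_pockets hval hpk
    unfold bound
    push_cast
    have : (0 : ℤ) ≤ (M.faceCells.sup fun f => (M.C.faceH f).natAbs : ℕ) := by positivity
    linarith

/-- **The bound in `configs` is redundant**: every valid height assignment on the free cells is a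
configuration (so `configs` is exactly the set of height configurations of the request, and `Z`
sums over all of them). [folklore] -/
theorem mem_configs_of_isValid {h : ↥M.freeCells → ℤ} (hval : M.IsValid h) : h ∈ M.configs := by
  refine (mem_configs_iff M h).mpr ⟨Fintype.mem_piFinset.mpr fun c => ?_, hval⟩
  rw [Finset.mem_Icc, ← abs_le]
  obtain ⟨⟨x, b⟩, hc⟩ := c
  cases b
  · have hb := M.abs_hv_le_of_isValid hval ((mem_freeCells_false M).mp hc)
    rw [hv_of_mem M h hc] at hb
    have : (0 : ℤ) ≤ 2 := by norm_num
    linarith [abs_nonneg (h ⟨(x, false), hc⟩)]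
  · have hb := M.abs_hf_le_of_isValid hval hc
    rwa [hf_of_mem M h hc] at hb

/-- Hence `configs` is precisely the set of valid assignments. [folklore] -/
theorem mem_configs_iff_isValid (h : ↥M.freeCells → ℤ) : h ∈ M.configs ↔ M.IsValid h :=
  ⟨fun hh => ((mem_configs_iff M h).mp hh).2, M.mem_configs_of_isValid⟩

end Configs

end Literature.Probability.LatticeModels.CollarLegModel
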